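import Summits.QuantumFields.YangMills.Theorems.UnitScaleTiltProp7LineAvgAdjoint
import Literature.MathematicalPhysics.QuantumFieldTheory.Balaban1983to89.B6GOneLevelV1Bridge
import Literature.MathematicalPhysics.QuantumFieldTheory.BalabanImbrieJaffe1984to88.BIJ85GaugeFnBound513
import HarnessLib

/-!
# Route `UnitScaleTilt`, crux K1 child «MinimiserStabilityRegPr» (stmt-QuantumFields-19200), registered stub `stub_prop7From14` (V3, skeleton v7
# cc37a1787726) — lane B, «the current is slaved to the curvature under the Euler–Lagrange port», FLAT HALF: **(i) the straight `k`-fold block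
# average of a transverse difference telescopes to the boundary layers (`|Q_k(∂^*_νg)| ≤ 2(L^k)⁻¹·sup|g|`); (ii) a multiplier current `Q_k^⊤W` is
# bounded by three times its own block averages (diagonally dominant normal operator of the p1 lineage); (iii) `Q*` of lit-balaban's one-level V1
# structure IS the tent field `Q_k^⊤`**

Cell `ym3-torus` ∕ fleet seat `ym-ust-19200-p3` (WIDTH-LEVER lane B of V3 «regularity of the minimiser straight from the Euler–Lagrange system»;
HUMAN RULING D-0037, YM ladder rung R3).  `--supports stmt-QuantumFields-19200 --as helper`.

WHY.  Print's regular space (2)∕(6) ([Balaban1985Variational] p. 278) has TWO members: small plaquette variables and small covariant divergence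
`(D*∂U)(b)`; the second is the Yang–Mills CURRENT.  For a critical configuration the Euler–Lagrange equation makes the current a multiplier current of the
block averaging ((127)∕(133) p. 297–298, (158) p. 302), i.e. a tent interpolation `Q_k^⊤λ` of coarse data; such fields are controlled by their own block
averages (§4), and the block average of a divergence telescopes across the block (§2) — so the current is SLAVED to the curvature, one power of `L^{−k}`
gained, with no Green's function.  This file is the flat∕lattice half; the sequel `UnitScaleTiltProp7CurrentSlaving` adds the covariant divergence of the
curvature and the d = 3 carrier in the port currency of `Prop7FlatSliceRegularityGauge.exists_repr_abs_le_of_multiplier_T3`.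

WHAT IS PROVED (sorry-free, no definition, standard axioms; every torus of `Setup`, `k` in the standing range):
* §1 `unshift_runSite_comm`, `runSite_unshift_succ` (lattice bookkeeping).
* §2 **`abs_sum_offsets_transverseDiff_le`** (`|Σ_{x∈B^k(y)}(g(x − e_ν) − g(x))| ≤ 2(L^k)^{d−1}·sup|g|`), its translate `…_runSite_le`, and
  **`abs_bondAvgIter_le_of_transverseDiff`**: a bond field whose `μ`-components are, up to `E`, `Σ_{ν∈S}(g_ν(x − e_ν) − g_ν(x))` with `|g_ν| ≤ G` has
  `|(Q_kX)(c)| ≤ 2·#S·(L^k)⁻¹·G + E` (`Q_k = LatticeFieldCalculus.bondAvgIter k` of [Balaban1984PropagatorsI] (1.18)).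
* §4 **`abs_adjField_le_of_bondAvgIter`** (`sup|Q_k^⊤W| ≤ 3·sup|Q_k(Q_k^⊤W)|`, from `Prop7LineAvgRightInverse.lineAvg_adjField`, `key_dominance`,
  `tridiag_sup_le`, `adjField_abs_le` BY NAME) and **`abs_le_of_sub_adjField_le`** (`|j − Q_k^⊤W| ≤ p` pointwise, `sup|Q_kj| ≤ B` ⇒ `sup|j| ≤ 3B + 4p`).
* §5 **`QsE_twoScale_empty_apply`**: for `twoScale k _ ∅` of `B6SectCTwoScaleV1` the adjoint `Q*ω` of [Balaban1984PropagatorsII] (2.18) is the tent field of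
  `ω` read on the level-`k` bonds (`Prop7LineAvgAdjoint.sum_adjField_mul_eq_bondAvgIter` + the adjoint characterisation).
HONEST SCOPE.  Lattice calculus and linear algebra only; nothing of Bałaban's nonlinear analysis; not a claim about the mass gap.

References: T. Bałaban, CMP **95** (1984) 17–40 [Balaban1984PropagatorsI] ((1.18) p.20); CMP **96** (1984) 223–250 [Balaban1984PropagatorsII] ((2.18)–(2.20)
p.226); CMP **102** (1985) 277–309 [Balaban1985Variational] ((2) p.278, (45)–(46) p.285, (127) p.297, (133) p.298, (158) p.302).
-/

set_option autoImplicit false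

noncomputable section

open scoped BigOperators

namespace Summit.QuantumFields.YangMills.Theorems.Prop7CurrentSlaving

open Literature.MathematicalPhysics.QuantumFieldTheory.Balaban1983to89
open Finset LatticeFieldCalculus B1RG242Torus
open Summit.QuantumFields.YangMills.Theorems.Prop7FlatCoercivity (iterate_shift_eq_runSite runSite_runSite runSite_apply_self
  runSite_apply_of_ne fibreSite_runSite sum_fibre_eq_sum_offsets bondAvgIter_eq_lineBlockAvg_real sitesPerDir_zero_eq_pow_mul)
open Summit.QuantumFields.YangMills.Theorems.Prop7LineAvgRightInverse (sum_offsets_eq_sum_split card_offsets_reset fibreSite_update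
  lineAvg_adjField adjField_abs_le tridiag_sup_le key_dominance tent_gamma_nonneg)

variable {P : Params}

/-! ## §1 Lattice bookkeeping -/

/-- Running along `μ` and stepping back along `ν` commute (also for `μ = ν`). [folklore] -/
theorem unshift_runSite_comm {j : ℕ} (x : Site P j) (μ ν : Fin P.d) (t : ℕ) :
    (runSite x μ t).unshift ν = runSite (x.unshift ν) μ t := by
  funext i
  by_cases hμ : i = μ
  · subst hμ
    by_cases hν : i = ν
    · subst hν
      simp only [Site.unshift, runSite, Function.update_self]
      ring
    · simp only [Site.unshift, runSite, Function.update_self, Function.update_of_ne hν]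
  · by_cases hν : i = ν
    · subst hν
      simp only [Site.unshift, runSite, Function.update_self, Function.update_of_ne hμ]
    · simp only [Site.unshift, runSite, Function.update_of_ne hμ, Function.update_of_ne hν]

/-- One step back then `s + 1` steps forward is `s` steps forward. [folklore] -/
theorem runSite_unshift_succ {j : ℕ} (x : Site P j) (ν : Fin P.d) (s : ℕ) :
    runSite (x.unshift ν) ν (s + 1) = runSite x ν s := by
  funext i
  by_cases hν : i = ν
  · subst hν
    simp only [Site.unshift, runSite, Function.update_self]
    push_cast
    ring
  · simp only [Site.unshift, runSite, Function.update_of_ne hν]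

/-! ## §2 The block average of a transverse difference telescopes to the boundary layers -/

section Telescoping

variable {k : ℕ}

/-- **TELESCOPING ACROSS A BLOCK**: for every site function `g` with `|g| ≤ G`, every `k`-block `B^k(y)` and every direction `ν`,
`|Σ_{x ∈ B^k(y)} (g(x − e_ν) − g(x))| ≤ 2·(L^k)^{d−1}·G` — along each of the `(L^k)^{d−1}` lines of the block in the direction `ν` the differences
telescope to the two end layers. [folklore] -/
theorem abs_sum_offsets_transverseDiff_le (y : Site P k) (ν : Fin P.d) (g : Site P 0 → ℝ) {G : ℝ} (hg : ∀ x, |g x| ≤ G) :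
    |∑ r : Fin P.d → Fin (P.L ^ k), (g ((Site.fibreSite 0 k y r).unshift ν) - g (Site.fibreSite 0 k y r))|
      ≤ 2 * (((P.L ^ k : ℕ) : ℝ) ^ (P.d - 1)) * G := by
  have hG : 0 ≤ G := (abs_nonneg _).trans (hg (Site.fibreSite 0 k y fun _ => ⟨0, pow_pos P.L_pos k⟩))
  rw [sum_offsets_eq_sum_split ν]
  -- each line contributes at most `2G`
  have hline : ∀ r₀ : {r : Fin P.d → Fin (P.L ^ k) // r ν = ⟨0, pow_pos P.L_pos k⟩},
      |∑ s : Fin (P.L ^ k), (g ((Site.fibreSite 0 k y (Function.update r₀.1 ν s)).unshift ν)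
        - g (Site.fibreSite 0 k y (Function.update r₀.1 ν s)))| ≤ 2 * G := by
    intro r₀
    obtain ⟨r₀, hr₀⟩ := r₀
    set x₀ : Site P 0 := Site.fibreSite 0 k y r₀ with hx₀
    have hupd : ∀ s : Fin (P.L ^ k), Site.fibreSite 0 k y (Function.update r₀ ν s) = runSite x₀ ν s :=
      fun s => fibreSite_update ν y r₀ hr₀ s
    simp only [hupd]
    rw [Fin.sum_univ_eq_sum_range (fun s => g ((runSite x₀ ν s).unshift ν) - g (runSite x₀ ν s)) (P.L ^ k)]
    -- `g((x₀ + s e_ν) − e_ν) = b s`, `g(x₀ + s e_ν) = b (s+1)` with `b s = g((x₀ − e_ν) + s e_ν)`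
    have hb : ∀ s : ℕ, g ((runSite x₀ ν s).unshift ν) - g (runSite x₀ ν s)
        = g (runSite (x₀.unshift ν) ν s) - g (runSite (x₀.unshift ν) ν (s + 1)) := by
      intro s
      rw [unshift_runSite_comm, runSite_unshift_succ]
    simp only [hb]
    rw [Finset.sum_range_sub']
    have h1 := hg (runSite (x₀.unshift ν) ν 0)
    have h2 := hg (runSite (x₀.unshift ν) ν (P.L ^ k))
    calc |g (runSite (x₀.unshift ν) ν 0) - g (runSite (x₀.unshift ν) ν (P.L ^ k))|
        ≤ |g (runSite (x₀.unshift ν) ν 0)| + |g (runSite (x₀.unshift ν) ν (P.L ^ k))| := abs_sub _ _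
      _ ≤ 2 * G := by linarith
  calc |∑ r₀ : {r : Fin P.d → Fin (P.L ^ k) // r ν = ⟨0, pow_pos P.L_pos k⟩}, ∑ s : Fin (P.L ^ k),
          (g ((Site.fibreSite 0 k y (Function.update r₀.1 ν s)).unshift ν) - g (Site.fibreSite 0 k y (Function.update r₀.1 ν s)))|
      ≤ ∑ r₀ : {r : Fin P.d → Fin (P.L ^ k) // r ν = ⟨0, pow_pos P.L_pos k⟩}, |∑ s : Fin (P.L ^ k),
          (g ((Site.fibreSite 0 k y (Function.update r₀.1 ν s)).unshift ν) - g (Site.fibreSite 0 k y (Function.update r₀.1 ν s)))| :=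
        Finset.abs_sum_le_sum_abs _ _
    _ ≤ ∑ _r₀ : {r : Fin P.d → Fin (P.L ^ k) // r ν = ⟨0, pow_pos P.L_pos k⟩}, 2 * G := Finset.sum_le_sum fun r₀ _ => hline r₀
    _ = 2 * (((P.L ^ k : ℕ) : ℝ) ^ (P.d - 1)) * G := by
        rw [Finset.sum_const, Finset.card_univ, card_offsets_reset ν, nsmul_eq_mul]
        push_cast
        ring


/-- The same along a translated block: the `t`-th translate in the direction `μ` of the lines of `B^k(y)`. [folklore] -/
theorem abs_sum_offsets_transverseDiff_runSite_le (y : Site P k) (μ ν : Fin P.d) (t : ℕ) (g : Site P 0 → ℝ) {G : ℝ}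
    (hg : ∀ x, |g x| ≤ G) :
    |∑ r : Fin P.d → Fin (P.L ^ k), (g ((runSite (Site.fibreSite 0 k y r) μ t).unshift ν) - g (runSite (Site.fibreSite 0 k y r) μ t))|
      ≤ 2 * (((P.L ^ k : ℕ) : ℝ) ^ (P.d - 1)) * G := by
  have h := abs_sum_offsets_transverseDiff_le y ν (fun x => g (runSite x μ t)) (G := G) (fun x => hg _)
  simp only [unshift_runSite_comm] at h ⊢
  exact h

/-- **THE STRAIGHT `k`-FOLD AVERAGE OF A SUM OF TRANSVERSE DIFFERENCES**: let `X` be a real bond field whose components in the direction `μ = c.dir`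
are, up to `E` pointwise, `Σ_{ν ∈ S}(g_ν(x − e_ν) − g_ν(x))` with `|g_ν| ≤ G`.  Then `|(Q_kX)(c)| ≤ 2·#S·(L^k)⁻¹·G + E` (`Q_k = bondAvgIter k` of
[Balaban1984PropagatorsI] (1.18), the `L^{k(d+1)}` bond visits of the `L^{kd}` straight contours of the block, normalised to an average): the
differences telescope line by line inside the block and only the two boundary layers, `2(L^k)^{d−1}` sites per translate, survive.
[cite: Balaban1984PropagatorsI, (1.18) p.20] -/
theorem abs_bondAvgIter_le_of_transverseDiff (hk : k ≤ P.m + P.K) (X : VecField P 0 ℝ) (c : PBond P k) (S : Finset (Fin P.d))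
    (g : Fin P.d → Site P 0 → ℝ) {G E : ℝ} (hG : ∀ ν x, |g ν x| ≤ G)
    (hX : ∀ x : Site P 0, |X ⟨x, c.dir⟩ - ∑ ν ∈ S, (g ν (x.unshift ν) - g ν x)| ≤ E) :
    |bondAvgIter k X c| ≤ 2 * S.card * ((P.L : ℝ) ^ k)⁻¹ * G + E := by
  have h := sitesPerDir_zero_eq_pow_mul hk
  have hn : (0 : ℝ) < (P.L : ℝ) ^ k := pow_pos (by exact_mod_cast P.L_pos) k
  have hE : 0 ≤ E := (abs_nonneg _).trans (hX (Site.fibreSite 0 k c.src fun _ => ⟨0, pow_pos P.L_pos k⟩))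
  have hG0 : 0 ≤ G := (abs_nonneg _).trans (hG ⟨0, P.hd⟩ (Site.fibreSite 0 k c.src fun _ => ⟨0, pow_pos P.L_pos k⟩))
  have hcast : ((P.L ^ k : ℕ) : ℝ) = (P.L : ℝ) ^ k := by push_cast; ring
  -- the remainder
  set R : Site P 0 → ℝ := fun x => X ⟨x, c.dir⟩ - ∑ ν ∈ S, (g ν (x.unshift ν) - g ν x) with hR
  have hXdec : ∀ x, X ⟨x, c.dir⟩ = (∑ ν ∈ S, (g ν (x.unshift ν) - g ν x)) + R x := fun x => by simp only [hR]; ring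
  rw [bondAvgIter_eq_lineBlockAvg_real hk X c]
  simp only [iterate_shift_eq_runSite]
  rw [sum_fibre_eq_sum_offsets h]
  simp only [hXdec, Finset.sum_add_distrib]
  -- the telescoping part
  have hD : |∑ r : Fin P.d → Fin (P.L ^ k), ∑ t ∈ range (P.L ^ k), ∑ ν ∈ S,
        (g ν ((runSite (Site.fibreSite 0 k c.src r) c.dir t).unshift ν) - g ν (runSite (Site.fibreSite 0 k c.src r) c.dir t))|
      ≤ (P.L ^ k : ℕ) * (S.card * (2 * (((P.L ^ k : ℕ) : ℝ) ^ (P.d - 1)) * G)) := by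
    rw [Finset.sum_comm]
    refine (Finset.abs_sum_le_sum_abs _ _).trans ?_
    refine (Finset.sum_le_sum fun t _ => ?_).trans (by rw [Finset.sum_const, Finset.card_range, nsmul_eq_mul])
    rw [Finset.sum_comm]
    refine (Finset.abs_sum_le_sum_abs _ _).trans ?_
    refine (Finset.sum_le_sum fun ν _ => ?_).trans (by rw [Finset.sum_const, nsmul_eq_mul])
    exact abs_sum_offsets_transverseDiff_runSite_le c.src c.dir ν t (g ν) (hG ν)
  -- the remainder part
  have hRsum : |∑ r : Fin P.d → Fin (P.L ^ k), ∑ t ∈ range (P.L ^ k), R (runSite (Site.fibreSite 0 k c.src r) c.dir t)|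
      ≤ ((P.L : ℝ) ^ k) ^ P.d * ((P.L : ℝ) ^ k * E) := by
    have hcard : ((Finset.univ : Finset (Fin P.d → Fin (P.L ^ k))).card : ℝ) = ((P.L : ℝ) ^ k) ^ P.d := by
      rw [Finset.card_univ, Fintype.card_fun, Fintype.card_fin, Fintype.card_fin]
      push_cast
      ring
    have hinner : ∀ r : Fin P.d → Fin (P.L ^ k),
        |∑ t ∈ range (P.L ^ k), R (runSite (Site.fibreSite 0 k c.src r) c.dir t)| ≤ (P.L : ℝ) ^ k * E := by
      intro r
      refine (Finset.abs_sum_le_sum_abs _ _).trans ?_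
      refine (Finset.sum_le_sum fun t _ => hX _).trans ?_
      rw [Finset.sum_const, Finset.card_range, nsmul_eq_mul]
      push_cast
      exact le_rfl
    refine (Finset.abs_sum_le_sum_abs _ _).trans ?_
    refine (Finset.sum_le_sum fun r _ => hinner r).trans ?_
    rw [Finset.sum_const, nsmul_eq_mul, hcard]
  rw [hcast] at hD
  set n : ℝ := (P.L : ℝ) ^ k with hndef
  set m : ℝ := n ^ (P.d - 1) with hmdef
  have hdpow : n ^ P.d = m * n := by
    rw [hmdef, ← pow_succ, Nat.sub_add_cancel P.hd]
  rw [hdpow] at hRsum ⊢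
  have hm0 : 0 < m := pow_pos hn _
  have hC0 : (0 : ℝ) ≤ (m * n * n)⁻¹ := by positivity
  have hmn : m * n ≠ 0 := by positivity
  have hmnn : m * n * n ≠ 0 := by positivity
  rw [abs_mul, abs_of_nonneg hC0]
  calc (m * n * n)⁻¹ *
        |∑ r : Fin P.d → Fin (P.L ^ k), ∑ t ∈ range (P.L ^ k), ∑ ν ∈ S,
            (g ν ((runSite (Site.fibreSite 0 k c.src r) c.dir t).unshift ν) - g ν (runSite (Site.fibreSite 0 k c.src r) c.dir t))
          + ∑ r : Fin P.d → Fin (P.L ^ k), ∑ t ∈ range (P.L ^ k), R (runSite (Site.fibreSite 0 k c.src r) c.dir t)|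
      ≤ (m * n * n)⁻¹ * (n * (S.card * (2 * m * G)) + m * n * (n * E)) :=
        mul_le_mul_of_nonneg_left ((abs_add_le _ _).trans (add_le_add hD hRsum)) hC0
    _ = 2 * S.card * n⁻¹ * G + E := by
        have h1 : (m * n * n)⁻¹ * (m * n) = n⁻¹ := by
          rw [mul_inv, mul_comm (m * n)⁻¹, mul_assoc, inv_mul_cancel₀ hmn, mul_one]
        rw [show n * (S.card * (2 * m * G)) + m * n * (n * E) = (m * n * n) * E + (m * n) * (2 * S.card * G) by ring,
          mul_add, ← mul_assoc, inv_mul_cancel₀ hmnn, one_mul, ← mul_assoc, h1]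
        ring

end Telescoping

/-! ## §4 Multiplier currents are controlled by their block averages (the diagonally dominant normal operator of the p1 lineage) -/

section Range

variable {k : ℕ}

/-- **A MULTIPLIER CURRENT IS BOUNDED BY THREE TIMES ITS BLOCK AVERAGES**: for the tent field `A = Q_k^⊤W` of a coarse bond field `W` (the transpose of
the straight `k`-fold average, `Prop7LineAvgRightInverse.adjField_*`), `sup|A| ≤ 3·sup|Q_kA|` — `Q_kA = TW` with `T` the tridiagonal normal operator,
diagonally dominant with ratio `< 1/2` uniformly in `k` and in the volume (`key_dominance`), so `max|W| ≤ 3L^{kd}·max|TW|`, and `|A| ≤ L^{−kd}max|W|`.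
[cite: Balaban1985Variational, (45)-(46) p.285; Balaban1984PropagatorsI, (1.18) p.20] -/
theorem abs_adjField_le_of_bondAvgIter (hk : k ≤ P.m + P.K) (W : PBond P k → ℝ) (A : PBond P 0 → ℝ)
    (hA : ∀ b : PBond P 0, A b = (((P.L : ℝ) ^ k) ^ P.d * (P.L : ℝ) ^ k)⁻¹ *
        (((((b.src b.dir).val % P.L ^ k : ℕ) : ℝ) + 1) * W ⟨Site.proj k k b.src, b.dir⟩
          + ((P.L ^ k - 1 - (b.src b.dir).val % P.L ^ k : ℕ) : ℝ) * W ⟨(Site.proj k k b.src).unshift b.dir, b.dir⟩))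
    {B : ℝ} (hM : ∀ c : PBond P k, |bondAvgIter k A c| ≤ B) : ∀ b : PBond P 0, |A b| ≤ 3 * B := by
  have h := sitesPerDir_zero_eq_pow_mul hk
  have hN : (0 : ℝ) < (P.L : ℝ) ^ k := pow_pos (by exact_mod_cast P.L_pos) k
  let α : ℝ := ∑ s : Fin (P.L ^ k), ((((s : ℕ) : ℝ) + 1) ^ 2 + (((P.L ^ k - 1 - (s : ℕ) : ℕ) : ℝ)) ^ 2)
  let γ : ℝ := ∑ s : Fin (P.L ^ k), (((s : ℕ) : ℝ) + 1) * ((P.L ^ k - 1 - (s : ℕ) : ℕ) : ℝ)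
  let D : ℝ := (((P.L : ℝ) ^ k) ^ P.d * (P.L : ℝ) ^ k)⁻¹ * ((((P.L ^ k : ℕ) : ℝ) ^ (P.d - 1)) *
      (((P.L : ℝ) ^ k) ^ P.d * (P.L : ℝ) ^ k)⁻¹)
  have hD : 0 ≤ D := by positivity
  have hγ : 0 ≤ γ := tent_gamma_nonneg _
  have hK : (0 : ℝ) ≤ 3 * ((P.L : ℝ) ^ k) ^ P.d := by positivity
  have key : 1 ≤ 3 * ((P.L : ℝ) ^ k) ^ P.d * (D * (α - 2 * γ)) := key_dominance P k
  -- `Q_kA = TW`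
  have hT : ∀ c : PBond P k, D * (α * W c + γ * W ⟨c.src.unshift c.dir, c.dir⟩ + γ * W ⟨runSite c.src c.dir 1, c.dir⟩)
      = bondAvgIter k A c := by
    intro c
    rw [bondAvgIter_eq_lineBlockAvg_real hk A c, lineAvg_adjField h W A hA c]
    ring
  intro b
  have hW := tridiag_sup_le D α γ W (bondAvgIter k A) hD hγ hT (3 * ((P.L : ℝ) ^ k) ^ P.d) hK key hM
  have := adjField_abs_le W A hA hW b
  calc |A b| ≤ (((P.L : ℝ) ^ k) ^ P.d)⁻¹ * (3 * ((P.L : ℝ) ^ k) ^ P.d * B) := this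
    _ = 3 * B := by field_simp

/-- **DEFECT FORM**: a bond field `j` within `p` of a multiplier current `Q_k^⊤W` pointwise and with block averages `|Q_kj| ≤ B` satisfies
`sup|j| ≤ 3B + 4p`. [cite: Balaban1985Variational, (133) p.298, (158) p.302] -/
theorem abs_le_of_sub_adjField_le (hk : k ≤ P.m + P.K) (W : PBond P k → ℝ) (A : PBond P 0 → ℝ)
    (hA : ∀ b : PBond P 0, A b = (((P.L : ℝ) ^ k) ^ P.d * (P.L : ℝ) ^ k)⁻¹ *
        (((((b.src b.dir).val % P.L ^ k : ℕ) : ℝ) + 1) * W ⟨Site.proj k k b.src, b.dir⟩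
          + ((P.L ^ k - 1 - (b.src b.dir).val % P.L ^ k : ℕ) : ℝ) * W ⟨(Site.proj k k b.src).unshift b.dir, b.dir⟩))
    (j : PBond P 0 → ℝ) {p B : ℝ} (hj : ∀ b, |j b - A b| ≤ p) (hM : ∀ c : PBond P k, |bondAvgIter k j c| ≤ B) :
    ∀ b : PBond P 0, |j b| ≤ 3 * B + 4 * p := by
  -- the block averages of `A = j − (j − A)`
  have hAe : A = j - (fun b => j b - A b) := by funext b; simp
  have hMA : ∀ c : PBond P k, |bondAvgIter k A c| ≤ B + p := by
    intro c
    have e : bondAvgIter k A c = bondAvgIter k j c - bondAvgIter k (fun b => j b - A b) c := by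
      conv_lhs => rw [hAe]
      rw [← B6SectAOntoV1.bondAvgIterLin_apply, map_sub]
      rfl
    rw [e]
    have h2 : |bondAvgIter k (fun b => j b - A b) c| ≤ p := by
      have := Literature.MathematicalPhysics.QuantumFieldTheory.BalabanImbrieJaffe1984to88.BIJ85GaugeFnBound513.norm_bondAvgIter_le k (fun b => j b - A b) (a := p)
        (fun b => by rw [Real.norm_eq_abs]; exact hj b) c
      rwa [Real.norm_eq_abs] at this
    exact (abs_sub _ _).trans (add_le_add (hM c) h2)
  intro b
  have h1 := abs_adjField_le_of_bondAvgIter hk W A hA hMA b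
  have h2 := hj b
  have h3 : |j b| ≤ |j b - A b| + |A b| := by
    have := abs_add_le (j b - A b) (A b); rwa [sub_add_cancel] at this
  linarith

end Range

/-! ## §5 The V1 dictionary: `Q*` of the one-level structure is the tent field -/

section Dictionary

open scoped InnerProductSpace
open B6SectAOperatorsV1 B6SectCTwoScaleV1 B6GOneLevelV1Bridge
open Literature.MathematicalPhysics.QuantumFieldTheory.BalabanImbrieJaffe1984to88.BIJ85AxialPropagator411 (BondSpace)
open Summit.QuantumFields.YangMills.Theorems.Prop7LineAvgAdjoint (sum_adjField_mul_eq_bondAvgIter)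

variable {k : ℕ}

/-- **`Q*` OF THE ONE-LEVEL STRUCTURE IS THE TENT FIELD**: for the nested family `twoScale k _ ∅` of lit-balaban's V1 model (constraints = the bonds of
`T^{(k)}`, `Q = Q_k`), the adjoint `Q*ω` of [Balaban1984PropagatorsII] (2.18) is the transpose-type field of the p1 lineage:
`(Q*ω)(b) = (L^{kd}L^k)⁻¹((s_b + 1)·ω(⟨ȳ_b, μ⟩) + (L^k − 1 − s_b)·ω(⟨ȳ_b − e_μ, μ⟩))`. [cite: Balaban1984PropagatorsII, (2.18)-(2.20) p.226; Balaban1984PropagatorsI, (1.18) p.20] -/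
theorem QsE_twoScale_empty_apply (hk1 : k + 1 ≤ P.m + P.K) (ω : BondIdxSpace (twoScale k hk1 (∅ : Finset (Site P (k + 1)))))
    (b : PBond P 0) :
    QsE (twoScale k hk1 (∅ : Finset (Site P (k + 1)))) ω b = (((P.L : ℝ) ^ k) ^ P.d * (P.L : ℝ) ^ k)⁻¹ *
        (((((b.src b.dir).val % P.L ^ k : ℕ) : ℝ) + 1) * ω (bondIdxOfEmpty hk1 ⟨Site.proj k k b.src, b.dir⟩)
          + ((P.L ^ k - 1 - (b.src b.dir).val % P.L ^ k : ℕ) : ℝ) * ω (bondIdxOfEmpty hk1 ⟨(Site.proj k k b.src).unshift b.dir, b.dir⟩)) := by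
  have hk : k ≤ P.m + P.K := by omega
  have h := sitesPerDir_zero_eq_pow_mul hk
  set W : PBond P k → ℝ := fun c => ω (bondIdxOfEmpty hk1 c) with hW
  set A : PBond P 0 → ℝ := fun b => (((P.L : ℝ) ^ k) ^ P.d * (P.L : ℝ) ^ k)⁻¹ *
        (((((b.src b.dir).val % P.L ^ k : ℕ) : ℝ) + 1) * W ⟨Site.proj k k b.src, b.dir⟩
          + ((P.L ^ k - 1 - (b.src b.dir).val % P.L ^ k : ℕ) : ℝ) * W ⟨(Site.proj k k b.src).unshift b.dir, b.dir⟩) with hAdef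
  have hA : ∀ b, A b = (((P.L : ℝ) ^ k) ^ P.d * (P.L : ℝ) ^ k)⁻¹ *
        (((((b.src b.dir).val % P.L ^ k : ℕ) : ℝ) + 1) * W ⟨Site.proj k k b.src, b.dir⟩
          + ((P.L ^ k - 1 - (b.src b.dir).val % P.L ^ k : ℕ) : ℝ) * W ⟨(Site.proj k k b.src).unshift b.dir, b.dir⟩) := fun b => rfl
  -- `Q*ω = A` as vectors, by the adjoint characterisation and the transpose identity
  have hvec : QsE (twoScale k hk1 (∅ : Finset (Site P (k + 1)))) ω = WithLp.toLp 2 A := by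
    refine ext_inner_right ℝ fun y => ?_
    rw [QsE, LinearMap.adjoint_inner_left, inner_eq_sum, inner_eq_sum, sum_bondIdx_twoScale_empty hk1]
    have hQ : ∀ c : PBond P k, QE (twoScale k hk1 (∅ : Finset (Site P (k + 1)))) y (bondIdxOfEmpty hk1 c)
        = bondAvgIter k (WithLp.ofLp y) c := fun c => rfl
    simp only [hQ]
    rw [← sum_adjField_mul_eq_bondAvgIter h W A hA hk (WithLp.ofLp y)]
  have := congrArg (fun v : BondSpace P => v b) hvec
  simp only at this
  rw [this]

end Dictionary

end Summit.QuantumFields.YangMills.Theorems.Prop7CurrentSlaving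

end
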